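import Literature.MathematicalPhysics.QuantumFieldTheory.WilsonPartitionRegularVariationProofs
import Literature.MeasureTheory.Group.HaarTubePushforwardMeasure
import HarnessLib

/-!
# The Wilson partition function as a Euclidean Laplace integral with real-analytic phase

Third proved layer of `WilsonPartitionRegularVariation` (see
`WilsonPartitionRegularVariationProofs.lean`): the group-to-Euclid reduction. Everything here is
PROVED; no definitions, no named facts.

For a compact group `G` with a faithful continuous unitary matrix representation `r` and a
torus side `L`, embed the configuration group `K = G^E` into the finite-dimensional real Banach
algebra `𝔸 = (M_N(ℂ))^E` (Frobenius norms) by `ρ^E`, and let `Ω ⊆ 𝔸` be the compact invariant tube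
of `ρ^E(K)` of `Literature.MeasureTheory.Group.exists_haar_lintegral_eq_tube` (Haar measure of `K`
is a constant multiple of the push-forward of Lebesgue measure on `Ω` under the group-part
projection `q`). Then (`exists_partitionFunction_eq_laplaceIntegral`)

  `Z_L(β) = c ∫_Ω e^{-β f(M)} dM`,  `β ∈ ℝ`,  `c > 0`,

where the phase `f = S̃ ∘ q` — `S̃(M) = Σₚ (N - Re tr (M_{e₁} M_{e₂} M_{e₃}ᴴ M_{e₄}ᴴ))` the Wilson
action written as a polynomial on `𝔸` (on `ρ^E(K)` the inverse is the conjugate transpose) — is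
REAL-ANALYTIC on the open tube `T ⊇ Ω`, non-negative on `Ω`, vanishes at the interior point
`1 ∈ Ω`, and `Ω = {M ∈ T : g(M) ≥ 0}` with `g` analytic: exactly the input format of the
asymptotic theory of Laplace integrals with analytic phase over compact semianalytic sets
(Arnold–Gusein-Zade–Varchenko II §7.3 Thm. 7.6; Lin, arXiv:1003.5338, Thm. 2.9).

Consequently (`wilsonPartitionRegularVariation_of_laplaceAsymptotics`) the named fact
`WilsonPartitionRegularVariation` follows from the leading-term form of that theory, taken here as
an explicit hypothesis (it is not in the tree: its printed proofs rest on Hironaka's resolution of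
singularities); the finite-group case `N = 0` is unconditional
(`tendsto_partitionFunction_of_finite`).

## References

* V. I. Arnold, S. M. Gusein-Zade, A. N. Varchenko, *Singularities of Differentiable Maps II*
  (2012), Part II §7.3 Thm. 7.6. [ArnoldGuseinzadeVarchenko2012]
* S. Lin, arXiv:1003.5338 = J. Alg. Stat. 8 (2017), Thm. 2.9, Prop. 3.2. [Lin2017]
* B. C. Hall, *Lie Groups, Lie Algebras, and Representations* (2015), Cor. 3.45. [Hall2015]
-/

noncomputable section

open MeasureTheory Filter Set Topology Function
open scoped Matrix.Norms.Frobenius ENNReal ContDiff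
open Literature.MeasureTheory.Group Literature.Analysis.Asymptotics

namespace Literature.MathematicalPhysics.QuantumFieldTheory

section Algebra

variable {N : ℕ}

/-- The conjugate transpose of `M_N(ℂ)` as a real-linear map. [folklore] -/
theorem exists_conjTranspose_clm :
    ∃ Lct : Matrix (Fin N) (Fin N) ℂ →L[ℝ] Matrix (Fin N) (Fin N) ℂ, ∀ A, Lct A = A.conjTranspose := by
  let L : Matrix (Fin N) (Fin N) ℂ →ₗ[ℝ] Matrix (Fin N) (Fin N) ℂ :=
    { toFun := fun A => A.conjTranspose
      map_add' := fun A B => Matrix.conjTranspose_add A B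
      map_smul' := fun c A => by
        rw [Matrix.conjTranspose_smul, RingHom.id_apply, star_trivial] }
  exact ⟨LinearMap.toContinuousLinearMap L, fun A => rfl⟩

/-- `A ↦ Re tr A` on `M_N(ℂ)` as a real-linear functional. [folklore] -/
theorem exists_reTrace_clm :
    ∃ τ : Matrix (Fin N) (Fin N) ℂ →L[ℝ] ℝ, ∀ A, τ A = A.trace.re := by
  let L : Matrix (Fin N) (Fin N) ℂ →ₗ[ℝ] ℝ :=
    { toFun := fun A => A.trace.re
      map_add' := fun A B => by rw [Matrix.trace_add, Complex.add_re]
      map_smul' := fun c A => by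
        rw [Matrix.trace_smul, RingHom.id_apply, Complex.real_smul, Complex.re_ofReal_mul,
          smul_eq_mul] }
  exact ⟨LinearMap.toContinuousLinearMap L, fun A => rfl⟩

variable {G : Type} [Group G] [TopologicalSpace G]

/-- A unitary representation maps inverses to conjugate transposes. [folklore] -/
theorem LatticeRep.map_inv_eq_conjTranspose (r : LatticeRep G) (g : G) :
    r.ρ g⁻¹ = (r.ρ g).conjTranspose := by
  have h1 : r.ρ g⁻¹ * r.ρ g = 1 := by rw [← map_mul, inv_mul_cancel, map_one]
  have h2 : r.ρ g * (r.ρ g).conjTranspose = 1 := Matrix.mem_unitaryGroup_iff.1 (r.mem_unitary g)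
  calc r.ρ g⁻¹ = r.ρ g⁻¹ * (r.ρ g * (r.ρ g).conjTranspose) := by rw [h2, mul_one]
    _ = (r.ρ g).conjTranspose := by rw [← mul_assoc, h1, one_mul]

end Algebra

section LaplaceForm

variable {G : Type} [Group G] [TopologicalSpace G] [IsTopologicalGroup G] [CompactSpace G]
  [MeasurableSpace G] [BorelSpace G]

/-- On the torus, the Haar probability measure of the configuration group `G^E` is the product of
the Haar probability measures of the links. [folklore] -/
theorem pi_haarProbability_eq_haarMeasure [SecondCountableTopology G] (L : ℕ) [NeZero L] :
    (Measure.pi fun _ : Edge 4 L => haarProbability G) =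
      Measure.haarMeasure (⊤ : TopologicalSpace.PositiveCompacts (GaugeConfig 4 L G)) := by
  haveI : IsProbabilityMeasure (Measure.haarMeasure
      (⊤ : TopologicalSpace.PositiveCompacts (GaugeConfig 4 L G))) :=
    ⟨Measure.haarMeasure_self⟩
  exact Measure.isHaarMeasure_eq_of_isProbabilityMeasure _ _

-- The product topology of `(M_N(ℂ))^E` and the topology of its (Frobenius/sup) norm are only
-- reducibly-different instances (tree idiom, cf. `QuantumLattice/RepLieAlgebra.lean`).
set_option backward.isDefEq.respectTransparency false in
/-- **The Wilson partition function as a Euclidean Laplace integral with analytic phase.** For a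
compact `G` with a faithful continuous unitary representation `r` of degree `N` and a torus
side `L`: in `𝔸 = (M_N(ℂ))^E` (any Borel structure on `M_N(ℂ)`; Mathlib registers no measurable
structure on matrices) with the additive Haar measure `μ` of its standard finite basis there
are an open `T`, a compact `Ω ⊆ T` with `1 ∈ interior Ω` and `Ω = {M ∈ T : 0 ≤ g M}`, functions
`f, g` real-analytic on `T` with `f ≥ 0` on `Ω`, `f 1 = 0`, and a constant `c > 0` such that
`Z_L(β) = c ∫_Ω e^{-β f} dμ` for all real `β` (tube of the compact linear group `ρ^E(G^E)`,
Haar = `c⁻¹ q_*(μ|_Ω)`, phase `f = S̃ ∘ q`). [folklore] -/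
theorem exists_partitionFunction_eq_laplaceIntegral (r : LatticeRep G) (L : ℕ)
    [NeZero L] [MeasurableSpace (Edge 4 L → Matrix (Fin r.N) (Fin r.N) ℂ)]
    [BorelSpace (Edge 4 L → Matrix (Fin r.N) (Fin r.N) ℂ)] :
    ∃ (T Ω : Set (Edge 4 L → Matrix (Fin r.N) (Fin r.N) ℂ))
      (f g : (Edge 4 L → Matrix (Fin r.N) (Fin r.N) ℂ) → ℝ) (c : ℝ),
      IsOpen T ∧ Ω ⊆ T ∧ IsCompact Ω ∧ (1 : Edge 4 L → Matrix (Fin r.N) (Fin r.N) ℂ) ∈ interior Ω ∧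
      Ω = {M ∈ T | 0 ≤ g M} ∧ AnalyticOnNhd ℝ f T ∧ AnalyticOnNhd ℝ g T ∧
      (∀ M ∈ Ω, 0 ≤ f M) ∧ f 1 = 0 ∧ 0 < c ∧
      ∀ β : ℝ, (partitionFunction (d := 4) (L := L) r.ρ β).toReal =
        c * ∫ M in Ω, Real.exp (-(β * f M))
          ∂(Module.finBasis ℝ (Edge 4 L → Matrix (Fin r.N) (Fin r.N) ℂ)).addHaar := by
  classical
  -- `G` is second countable: `r.ρ` is a closed embedding into a matrix space
  -- (= `LatticeRep.secondCountableTopology` of `BalabanBlockSpecification.lean`, not imported here).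
  haveI : SecondCountableTopology G :=
    (r.continuous.isClosedEmbedding r.injective).isEmbedding.secondCountableTopology
  -- the embedding `ρ^E : G^E →* 𝔸`
  set ρE : GaugeConfig 4 L G →* (Edge 4 L → Matrix (Fin r.N) (Fin r.N) ℂ) :=
    MonoidHom.compLeft r.ρ (Edge 4 L) with hρE
  have hρEapply : ∀ (U : GaugeConfig 4 L G) (e : Edge 4 L), ρE U e = r.ρ (U e) := fun U e => rfl
  have hρEc : Continuous ρE :=
    continuous_pi fun e => r.continuous.comp (continuous_apply e)
  have hρEi : Injective ρE := fun U V h => funext fun e => r.injective (congrFun h e)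
  set μ : Measure (Edge 4 L → Matrix (Fin r.N) (Fin r.N) ℂ) :=
    (Module.finBasis ℝ (Edge 4 L → Matrix (Fin r.N) (Fin r.N) ℂ)).addHaar with hμ
  obtain ⟨T, Ω, q, g, qK, c, hTopen, hΩT, hΩcpt, h1int, hΩeq, hqan, hgan, hq1, hqK, hc0, hctop,
    hlin⟩ := exists_haar_lintegral_eq_tube ρE hρEc hρEi μ
  -- the polynomial action `S̃` and the phase `f = S̃ ∘ q`
  obtain ⟨Lct, hLct⟩ := exists_conjTranspose_clm (N := r.N)
  obtain ⟨τ, hτ⟩ := exists_reTrace_clm (N := r.N)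
  let S : (Edge 4 L → Matrix (Fin r.N) (Fin r.N) ℂ) → ℝ := fun M =>
    ∑ p : Plaquette 4 L, ((r.N : ℝ) - τ (M (p.1, p.2.1.1) * M (p.1.shift p.2.1.1, p.2.1.2) *
      Lct (M (p.1.shift p.2.1.2, p.2.1.1)) * Lct (M (p.1, p.2.1.2))))
  have hSρ : ∀ U : GaugeConfig 4 L G, S (ρE U) = wilsonAction r.ρ U := by
    intro U
    simp only [S, wilsonAction, plaquetteHolonomy, map_mul, hρEapply, hLct, hτ,
      r.map_inv_eq_conjTranspose]
  have hSan : AnalyticOnNhd ℝ S univ := by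
    have hev : ∀ e : Edge 4 L, AnalyticOnNhd ℝ
        (fun M : Edge 4 L → Matrix (Fin r.N) (Fin r.N) ℂ => M e) univ := fun e =>
      (ContinuousLinearMap.proj (R := ℝ) (φ := fun _ : Edge 4 L => Matrix (Fin r.N) (Fin r.N) ℂ)
        e).analyticOnNhd _
    have hevH : ∀ e : Edge 4 L, AnalyticOnNhd ℝ
        (fun M : Edge 4 L → Matrix (Fin r.N) (Fin r.N) ℂ => Lct (M e)) univ := fun e =>
      (Lct.analyticOnNhd _).comp (hev e) (mapsTo_univ _ _)
    refine Finset.analyticOnNhd_fun_sum _ fun p _ => analyticOnNhd_const.sub ?_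
    exact (τ.analyticOnNhd _).comp ((((hev _).mul (hev _)).mul (hevH _)).mul (hevH _))
      (mapsTo_univ _ _)
  let f : (Edge 4 L → Matrix (Fin r.N) (Fin r.N) ℂ) → ℝ := fun M => S (q M)
  have hfan : AnalyticOnNhd ℝ f T := hSan.comp hqan (mapsTo_univ _ _)
  have hfq : ∀ M ∈ T, f M = wilsonAction r.ρ (qK M) := fun M hM => by
    show S (q M) = _
    rw [← hqK M hM, hSρ]
  have hf0 : ∀ M ∈ Ω, 0 ≤ f M := fun M hM => by
    rw [hfq M (hΩT hM)]; exact r.wilsonAction_nonneg _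
  have hf1 : f 1 = 0 := by
    show S (q 1) = 0
    rw [hq1, show (1 : Edge 4 L → Matrix (Fin r.N) (Fin r.N) ℂ) = ρE 1 by rw [map_one], hSρ]
    exact wilsonAction_one_eq_zero r.ρ
  -- `Z_L(β) = c⁻¹ ∫_Ω e^{-β f} dμ`
  have hZ : ∀ β : ℝ, (partitionFunction (d := 4) (L := L) r.ρ β).toReal =
      (c.toReal)⁻¹ * ∫ M in Ω, Real.exp (-(β * f M)) ∂μ := by
    intro β
    have hF : Measurable fun U : GaugeConfig 4 L G =>
        ENNReal.ofReal (Real.exp (-β * wilsonAction r.ρ U)) :=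
      ENNReal.measurable_ofReal.comp (Real.measurable_exp.comp
        ((WilsonRP.measurable_wilsonAction r.ρ r.continuous).const_mul _))
    have hZ' : partitionFunction (d := 4) (L := L) r.ρ β =
        ∫⁻ U, ENNReal.ofReal (Real.exp (-β * wilsonAction r.ρ U))
          ∂Measure.haarMeasure (⊤ : TopologicalSpace.PositiveCompacts (GaugeConfig 4 L G)) := by
      simp only [partitionFunction, wilsonWeight, withDensity_apply _ MeasurableSet.univ,
        Measure.restrict_univ, pi_haarProbability_eq_haarMeasure (G := G) L]
    have key := hlin _ hF
    rw [← hZ'] at key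
    -- rewrite the right-hand side through `f`
    have hΩmeas : MeasurableSet Ω := hΩcpt.isClosed.measurableSet
    have hrhs : ∫⁻ M in Ω, ENNReal.ofReal (Real.exp (-β * wilsonAction r.ρ (qK M))) ∂μ =
        ∫⁻ M in Ω, ENNReal.ofReal (Real.exp (-(β * f M))) ∂μ := by
      refine setLIntegral_congr_fun hΩmeas fun M hM => ?_
      rw [hfq M (hΩT hM), neg_mul]
    rw [hrhs] at key
    have hint : IntegrableOn (fun M => Real.exp (-(β * f M))) Ω μ := by
      refine ContinuousOn.integrableOn_compact hΩcpt ?_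
      exact Real.continuous_exp.comp_continuousOn
        ((continuousOn_const.mul (hfan.continuousOn.mono hΩT)).neg)
    have hofReal : ∫⁻ M in Ω, ENNReal.ofReal (Real.exp (-(β * f M))) ∂μ =
        ENNReal.ofReal (∫ M in Ω, Real.exp (-(β * f M)) ∂μ) :=
      (ofReal_integral_eq_lintegral_ofReal hint
        (ae_of_all _ fun M => (Real.exp_pos _).le)).symm
    rw [hofReal] at key
    have hcr : c.toReal ≠ 0 := ENNReal.toReal_ne_zero.2 ⟨hc0, hctop⟩
    have := congrArg ENNReal.toReal key
    rw [ENNReal.toReal_mul, ENNReal.toReal_ofReal (integral_nonneg fun M => (Real.exp_pos _).le)]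
      at this
    calc (partitionFunction (d := 4) (L := L) r.ρ β).toReal
        = (c.toReal)⁻¹ * (c.toReal * (partitionFunction (d := 4) (L := L) r.ρ β).toReal) := by
          field_simp
      _ = (c.toReal)⁻¹ * ∫ M in Ω, Real.exp (-(β * f M)) ∂μ := by rw [this]
  refine ⟨T, Ω, f, g, (c.toReal)⁻¹, hTopen, hΩT, hΩcpt, h1int, hΩeq, hfan, hgan, hf0, hf1,
    inv_pos.2 (ENNReal.toReal_pos hc0 hctop), hZ⟩

end LaplaceForm

section Reduction

-- Same topology-instance bridge as above.
set_option backward.isDefEq.respectTransparency false in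
/-- **`WilsonPartitionRegularVariation` from the asymptotic theory of Laplace integrals with a
real-analytic phase.** The hypothesis is the leading-term form of that theory over compact
semianalytic sets (Lin, arXiv:1003.5338, Thm. 2.9 with Cor. 2.6 and Prop. 3.2 — the semi-global
form of Arnold–Gusein-Zade–Varchenko II, §7.3 Thm. 7.6 with Thm. 7.5 §§1, 2, 4): for `E` a real
normed space of dimension `d ≥ 1` with an additive Haar measure, `f, gⱼ` analytic and `φ` smooth on
an open `U`, `Ω = {x ∈ U : gⱼ x ≥ 0 ∀ j}` compact, `φ > 0` on `Ω`, and `f` vanishing at an interior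
point of `Ω`, there are `C > 0`, a rational `λ ≥ 0` and `m ≤ d - 1` with
`τ^λ (log τ)^{-m} ∫_Ω e^{-τ|f|} φ → C`. Here `λ = 0` (with `m = 0`, `C = ∫_{Ω ∩ f⁻¹(0)} φ`) occurs
exactly when `f` vanishes on a subset of `Ω` of positive measure (e.g. `f ≡ 0` near the interior
zero, which the hypotheses allow — so `λ > 0` must NOT be demanded unconditionally); otherwise
`λ > 0` is the real log canonical threshold of `f` over `Ω` and `m + 1` its multiplicity (Lin,
Thm. 2.9). It is NOT proved in the tree (every printed proof rests on Hironaka's resolution of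
singularities); granted it, the named fact follows from `exists_partitionFunction_eq_laplaceIntegral`
(`N ≥ 1`) and `tendsto_partitionFunction_of_finite` (`N = 0`, where `G` is trivial).
[cite: Lin2017, arXiv:1003.5338 Thm. 2.9 with Cor. 2.6 and Prop. 3.2] -/
theorem wilsonPartitionRegularVariation_of_laplaceAsymptotics
    (hX : ∀ (E : Type) [NormedAddCommGroup E] [NormedSpace ℝ E] [FiniteDimensional ℝ E]
      [MeasurableSpace E] [BorelSpace E] (μ : Measure E) [μ.IsAddHaarMeasure],
      0 < Module.finrank ℝ E →
      ∀ (U : Set E) (f : E → ℝ) (l : ℕ) (g : Fin l → E → ℝ) (φ : E → ℝ),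
        IsOpen U → AnalyticOnNhd ℝ f U → (∀ j, AnalyticOnNhd ℝ (g j) U) → ContDiffOn ℝ ∞ φ U →
        IsCompact {x ∈ U | ∀ j, 0 ≤ g j x} → (∀ x ∈ {x ∈ U | ∀ j, 0 ≤ g j x}, 0 < φ x) →
        (∃ x₀ ∈ interior {x ∈ U | ∀ j, 0 ≤ g j x}, f x₀ = 0) →
        ∃ (C : ℝ) (lam : ℚ) (m : ℕ), 0 < C ∧ 0 ≤ lam ∧ m < Module.finrank ℝ E ∧
          Tendsto (fun τ : ℝ => τ ^ (lam : ℝ) / Real.log τ ^ m *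
              ∫ x in {x ∈ U | ∀ j, 0 ≤ g j x}, Real.exp (-(τ * |f x|)) * φ x ∂μ)
            atTop (𝓝 C)) :
    WilsonPartitionRegularVariation := by
  intro G _ _ _ _ _ _ r L _
  rcases Nat.eq_zero_or_pos r.N with hN | hN
  · -- degree `0`: the faithful representation forces `G` to be trivial, in particular finite
    haveI : Subsingleton (Matrix (Fin r.N) (Fin r.N) ℂ) := by
      rw [hN]; infer_instance
    haveI : Finite G := @Finite.of_subsingleton G (r.injective.subsingleton)
    obtain ⟨C, hC, h⟩ := tendsto_partitionFunction_of_finite r L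
    exact ⟨C, 0, 0, hC, le_rfl, h⟩
  · letI : MeasurableSpace (Edge 4 L → Matrix (Fin r.N) (Fin r.N) ℂ) := borel _
    haveI : BorelSpace (Edge 4 L → Matrix (Fin r.N) (Fin r.N) ℂ) := ⟨rfl⟩
    obtain ⟨T, Ω, f, g, c, hTopen, hΩT, hΩcpt, h1int, hΩeq, hfan, hgan, hf0, hf1, hc, hZ⟩ :=
      exists_partitionFunction_eq_laplaceIntegral r L
    haveI : Nonempty (Fin r.N) := ⟨⟨0, hN⟩⟩
    have hdim : 0 < Module.finrank ℝ (Edge 4 L → Matrix (Fin r.N) (Fin r.N) ℂ) :=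
      Module.finrank_pos
    have hΩmeas : MeasurableSet Ω := hΩcpt.isClosed.measurableSet
    obtain ⟨C, lam, m, hC, hlam, -, hlim⟩ := hX (Edge 4 L → Matrix (Fin r.N) (Fin r.N) ℂ)
      (Module.finBasis ℝ (Edge 4 L → Matrix (Fin r.N) (Fin r.N) ℂ)).addHaar hdim T f 1
      (fun _ => g) (fun _ => 1) hTopen hfan (fun _ => hgan) contDiffOn_const
      (by simpa [← hΩeq] using hΩcpt) (fun x _ => one_pos) ⟨1, by simpa [← hΩeq] using h1int, hf1⟩
    have hlim' : Tendsto (fun τ : ℝ => τ ^ (lam : ℝ) / Real.log τ ^ m *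
        ∫ x in Ω, Real.exp (-(τ * |f x|))
          ∂(Module.finBasis ℝ (Edge 4 L → Matrix (Fin r.N) (Fin r.N) ℂ)).addHaar) atTop (𝓝 C) := by
      simpa [← hΩeq] using hlim
    have hint : ∀ τ : ℝ, ∫ x in Ω, Real.exp (-(τ * |f x|))
        ∂(Module.finBasis ℝ (Edge 4 L → Matrix (Fin r.N) (Fin r.N) ℂ)).addHaar =
        ∫ x in Ω, Real.exp (-(τ * f x))
          ∂(Module.finBasis ℝ (Edge 4 L → Matrix (Fin r.N) (Fin r.N) ℂ)).addHaar := fun τ =>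
      setIntegral_congr_fun hΩmeas fun x hx => by rw [abs_of_nonneg (hf0 x hx)]
    simp_rw [hint] at hlim'
    refine ⟨c * C, lam, m, mul_pos hc hC, by exact_mod_cast hlam, ?_⟩
    refine (hlim'.const_mul c).congr' (Eventually.of_forall fun β => ?_)
    dsimp only
    rw [hZ β]
    ring

end Reduction

end Literature.MathematicalPhysics.QuantumFieldTheory

end
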